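import Summits.CriticalPhenomena.PercolationContinuityZ3.Theorems.PercNearOneGluingNoHeavyLowerTailThreePartitionLift
import Summits.CriticalPhenomena.PercolationContinuityZ3.Theorems.PercNearOneGluingNoHeavyLowerTailThreePartitionADTwisted

/-!
# `NoHeavyLowerTail` (crux stmt-CriticalPhenomena-4575): slot symmetries of the three-partition counts and the TWISTED functional with one
# trivial slot — `threePartNT τ univ 𝒱 𝒲 = topT τ (𝒱∩𝒲) − deeT τ 𝒱 𝒲 ≥ 0` for every twist `τ`

Support file (lane `prim-ineq-gen-4`, generation 15; `--supports stmt-CriticalPhenomena-4575`).  Pure proofs, no definitions, no `sorry`, standard axioms.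
Generic slot symmetries of the partition count `tri` of `…ThreePartitionAD` (`tri_swap12`: parts 1 ↔ 2; `tri_swap13`: parts 1 ↔ 3), hence for every twist
`τ` (`…ThreePartitionADTwisted`): `teeT τ univ 𝒱 𝒲 = deeT τ 𝒱 𝒲`, `deeT τ univ ℬ = topT τ ℬ`, `deeT τ 𝒜 ℬ = deeT τ ℬ 𝒜`, and the base case of every induction on the
principal slot in the twisted model: **`threePartNT_univ_nonneg`** — `0 ≤ threePartNT τ univ 𝒱 𝒲` for up-sets `𝒱, 𝒲` ("Kleitman twice" on every profile; the untwisted case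
`τ = ∅` is the tree's `threePartN_univ_nonneg`).  This is the base of the successor's planned twisted cone steps (memo
`run/shared/lean/prim/prim-ineq-gen-4/FINDING-LEVEL2-CUBE-TPP-g15.md` §5(a)); HONEST LABEL: a trivial-slot face of `ThreePartitionPositivityTwisted`, not the conjecture. [this work]
-/

noncomputable section

open Finset
open scoped symmDiff Classical

namespace Summit.CriticalPhenomena.PercolationContinuityZ3.Theorems.ThreePartition

variable {ι : Type*} [Fintype ι]

/-- Swapping parts 1 and 2 does not change a 3-partition count. [this work] -/
theorem tri_swap12 (p : Set ι → Set ι → Set ι → Prop) : tri p = tri (fun S₁ S₂ S₃ => p S₂ S₁ S₃) := by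
  unfold tri
  refine card_bij' (fun q _ => (q.2, q.1)) (fun q _ => (q.2, q.1)) ?_ ?_ (fun q _ => rfl) (fun q _ => rfl)
  · intro q hq
    simp only [mem_filter, mem_univ, true_and] at hq ⊢
    exact ⟨hq.1.symm, by rw [Set.union_comm]; exact hq.2⟩
  · intro q hq
    simp only [mem_filter, mem_univ, true_and] at hq ⊢
    exact ⟨hq.1.symm, by rw [Set.union_comm]; exact hq.2⟩

/-- Swapping parts 1 and 3 does not change a 3-partition count. [this work] -/
theorem tri_swap13 (p : Set ι → Set ι → Set ι → Prop) : tri p = tri (fun S₁ S₂ S₃ => p S₃ S₂ S₁) := by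
  unfold tri
  refine card_bij' (fun q _ => ((q.1 ∪ q.2)ᶜ, q.2)) (fun q _ => ((q.1 ∪ q.2)ᶜ, q.2)) ?_ ?_ ?_ ?_
  · intro q hq
    simp only [mem_filter, mem_univ, true_and] at hq ⊢
    obtain ⟨hd, hp⟩ := hq
    refine ⟨Set.disjoint_left.2 fun x hx hx2 => hx (Or.inr hx2), ?_⟩
    rw [compl_union_compl_union_eq hd]; exact hp
  · intro q hq
    simp only [mem_filter, mem_univ, true_and] at hq ⊢
    obtain ⟨hd, hp⟩ := hq
    refine ⟨Set.disjoint_left.2 fun x hx hx2 => hx (Or.inr hx2), ?_⟩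
    rw [compl_union_compl_union_eq hd]; exact hp
  · intro q hq
    simp only [mem_filter, mem_univ, true_and] at hq
    exact Prod.ext (compl_union_compl_union_eq hq.1) rfl
  · intro q hq
    simp only [mem_filter, mem_univ, true_and] at hq
    exact Prod.ext (compl_union_compl_union_eq hq.1) rfl

/-- `teeT τ ⊤ 𝒱 𝒲 = deeT τ 𝒱 𝒲` (swap parts 1 and 2). [this work] -/
theorem teeT_univ (τ : Set ι) (𝒱 𝒲 : Set (Set ι)) : teeT τ (Set.univ : Set (Set ι)) 𝒱 𝒲 = deeT τ 𝒱 𝒲 := by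
  unfold teeT deeT triT
  rw [tri_swap12]
  exact tri_congr fun S₁ S₂ _ => by simp only [Set.mem_univ, true_and]

/-- `deeT τ ⊤ ℬ = topT τ ℬ`. [this work] -/
theorem deeT_univ (τ : Set ι) (ℬ : Set (Set ι)) : deeT τ (Set.univ : Set (Set ι)) ℬ = topT τ ℬ := by
  unfold deeT topT triT
  exact tri_congr fun S₁ S₂ _ => by simp only [Set.mem_univ, true_and]

/-- `deeT` is symmetric in its two families (swap parts 1 and 3). [this work] -/
theorem deeT_comm (τ : Set ι) (𝒜 ℬ : Set (Set ι)) : deeT τ 𝒜 ℬ = deeT τ ℬ 𝒜 := by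
  unfold deeT triT
  rw [tri_swap13]
  exact tri_congr fun S₁ S₂ _ => And.comm

/-- **Twisted three-partition positivity with one trivial slot** (every twist `τ`, every finite ground set):
`0 ≤ threePartNT τ univ 𝒱 𝒲 (= topT τ (𝒱∩𝒲) − deeT τ 𝒱 𝒲)` for up-sets `𝒱, 𝒲`. [this work] -/
theorem threePartNT_univ_nonneg (τ : Set ι) {𝒱 𝒲 : Set (Set ι)} (h𝒱 : IsUpperSet 𝒱) (h𝒲 : IsUpperSet 𝒲) :
    0 ≤ threePartNT τ (Set.univ : Set (Set ι)) 𝒱 𝒲 := by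
  unfold threePartNT
  simp only [Set.univ_inter]
  rw [teeT_univ, deeT_univ, deeT_comm τ 𝒲 𝒱]
  have h := deeT_le_topT τ h𝒱 h𝒲
  push_cast
  omega

end Summit.CriticalPhenomena.PercolationContinuityZ3.Theorems.ThreePartition
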